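import Summits.PneNP.PneNP.Theorems.Capture.Negative.FixedWidth
import Literature.Computability.Complexity.PseudoComplementCircuits
import Literature.Computability.Complexity.SliceFunctionsProofs
import Literature.Computability.Complexity.DeMorganSimulation

/-!
# `Capture` (stmt-PneNP-2659, route PneNP/ConvexRankGates) — negative-side lemmas: the positive boundary (slice functions)

Standing-adversary (cdisprove, gen 3 / cycle 3) output for the crux
`Summit.PneNP.PneNP.Theses.ConvexRankGates.Capture`. Where the crux is ALREADY A THEOREM, so that
refuters do not look there and provers see what the general case must add:

* `exists_doubleRail` — double rail (Jukna 2012 §1.2 / §10.1): a `{∧₂,∨₂,¬}`-program with `L` gates has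
  a monotone `{∧₂,∨₂,0,1}`-program on the doubled input `ι ⊕ ι` with `≤ 2 + 2L` gates carrying every wire
  and its complement when fed with `(x, ¬x)` (`∧ ↦ (∧,∨)`, `∨ ↦ (∨,∧)`, `¬ ↦` swap the rails).
* `cktSize_slice_of_deMorgan` — Berkowitz's theorem WITHOUT tightness bookkeeping: a `k`-slice function
  with a `{∧₂,∨₂,¬}`-program of `t` gates has a `{∧₂,∨₂,0,1}`-program of `c + 2 + 2t` gates, `c` = the
  size of the tree's pseudo-complement program (`pseudoComplements_cktSize_holds`, Wegener 1987 Thm 6.13.3):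
  feed the negative rail with `Th_k(x - xᵢ)`; (10.1) on the slice, monotone sandwich off it.
* `captureSlice_monotoneBasis01`, `captureSlice` — **`Capture` restricted to slice functions HOLDS**, with
  ONE absolute exponent and target basis `{∧₂,∨₂,0,1} ⊆ B_1` (no CONV / PERM / GRANK gate): `B₂ → {∧,∨,¬}`
  (`CktSize.deMorgan_of_B2`, `12t+3`), double rail, pseudo-complements; `n` below the threshold of the
  pseudo-complement fact by monotone Shannon expansion (`cktSize_monotone_univ_fin`).

Consequence for the counterexample space (with the AUTOMATIC CASES of the work file, §9: few minterms or
few maxterms ⇒ one CONV gate): a refutation of the crux needs a non-sliceable monotone P-function with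
super-polynomially many minterms AND maxterms (matching, Tardos's function, LIN-UNSAT are of this kind and
are single gates; central slices of NP-hard functions — route OneSlice — are excluded here).

Refuter seat cdisprove-stmt-PneNP-2659-g3, 2026-08-16. Crux work file: `Cruxes/Capture/Disproof.lean` §15.
-/

set_option linter.dupNamespace false -- `Summit.PneNP.PneNP.…`: summit = sub-problem (D-0017)

namespace Summit.PneNP.PneNP.Theorems.Capture.Negative

open Literature.Computability.Complexity Literature.Computability.Complexity.GateList Finset

section DoubleRail

variable {ι : Type*}

/-- The two rails of an input: `x` and `¬x` as one assignment of `ι ⊕ ι`. [folklore] -/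
def rails (x : ι → Bool) : ι ⊕ ι → Bool := Sum.elim x fun i => !x i

/-- Specification of a DOUBLE-RAIL simulation `F` of the program `gs`: fed with the rails of `x`,
the positive copy of wire `w` carries its value in `gs` and the negative copy the complement
(out-of-range gate wires: `false` / `true`). [folklore] -/
def DRSpec (gs : List (Gate ι)) (F : (ι ⊕ ι → Bool) → (ι ⊕ ℕ) ⊕ (ι ⊕ ℕ) → Bool) : Prop :=
  ∀ (x : ι → Bool) (w : ι ⊕ ℕ), F (rails x) (Sum.inl w) = wireOf x (vals gs x) w ∧
    F (rails x) (Sum.inr w) = !wireOf x (vals gs x) w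

/-- Two constants cost two gates over `{∧₂,∨₂,0,1}`. [folklore] -/
theorem cktSize_false_true (κ : Type*) :
    CktSize monotoneBasis01 (fun (_ : κ → Bool) => Sum.elim (fun _ : Unit => false) fun _ : Unit => true)
      (1 + 1) :=
  (cktSize_const_mono01 κ false).pair (cktSize_const_mono01 κ true)

/-- Old wires keep their values when a gate is appended (wires beyond stay junk). [folklore] -/
theorem wireOf_vals_append_singleton_of_ne (gs : List (Gate ι)) (g : Gate ι) (x : ι → Bool)
    {w : ι ⊕ ℕ} (hw : w ≠ Sum.inr gs.length) :
    wireOf x (vals (gs ++ [g]) x) w = wireOf x (vals gs x) w := by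
  rcases w with i | m
  · simp
  · simp only [wireOf_inr, vals_append_singleton]
    have hm : m ≠ gs.length := fun h => hw (by rw [h])
    rcases lt_or_gt_of_ne hm with hlt | hgt
    · rw [List.getD_append _ _ _ _ (by rw [length_vals]; exact hlt)]
    · rw [List.getD_eq_default _ _ (by
          rw [List.length_append, length_vals, List.length_singleton]; omega),
        List.getD_eq_default _ _ (by rw [length_vals]; omega)]

/-- The new wire carries the new gate's value. [folklore] -/
theorem wireOf_vals_append_singleton_self (gs : List (Gate ι)) (g : Gate ι) (x : ι → Bool) :
    wireOf x (vals (gs ++ [g]) x) (Sum.inr gs.length) =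
      g.op (fun a => wireOf x (vals gs x) (g.args a)) := by
  simp only [wireOf_inr, vals_append_singleton]
  rw [List.getD_append_right _ _ _ _ (length_vals gs x).le, length_vals, Nat.sub_self,
    List.getD_cons_zero]

/-- **Double rail** (Jukna 2012, §1.2 / §10.1: "negations can be pushed to the inputs at the cost of
doubling the size"): every `{∧₂, ∨₂, ¬}`-program with `L` gates has a MONOTONE program over
`{∧₂, ∨₂, 0, 1}` on the doubled input `ι ⊕ ι`, with at most `2 + 2L` gates, carrying every wire and
its complement when fed with `(x, ¬x)`: `∧ ↦ (∧, ∨)`, `∨ ↦ (∨, ∧)`, `¬ ↦ swap the rails` (free).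
[folklore] -/
theorem exists_doubleRail [DecidableEq ι] : ∀ gs : List (Gate ι), (∀ g ∈ gs, g.fn ∈ deMorganBasis) →
    ∃ F : (ι ⊕ ι → Bool) → (ι ⊕ ℕ) ⊕ (ι ⊕ ℕ) → Bool,
      DRSpec gs F ∧ CktSize monotoneBasis01 F (2 + 2 * gs.length) := by
  intro gs
  induction gs using List.reverseRecOn with
  | nil =>
    intro _
    refine ⟨fun y w => match w with
      | Sum.inl (Sum.inl i) => y (Sum.inl i)
      | Sum.inr (Sum.inl i) => y (Sum.inr i)
      | Sum.inl (Sum.inr _) => false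
      | Sum.inr (Sum.inr _) => true, ?_, ?_⟩
    · intro x w
      rcases w with i | m <;> simp [rails]
    · have h := (CktSize.id monotoneBasis01 (ι := ι ⊕ ι)).pair (cktSize_false_true (ι ⊕ ι))
      refine ((h.outMap fun w : (ι ⊕ ℕ) ⊕ (ι ⊕ ℕ) => match w with
        | Sum.inl (Sum.inl i) => Sum.inl (Sum.inl i)
        | Sum.inr (Sum.inl i) => Sum.inl (Sum.inr i)
        | Sum.inl (Sum.inr _) => Sum.inr (Sum.inl ())
        | Sum.inr (Sum.inr _) => Sum.inr (Sum.inr ())).of_le (by simp)).congr fun y w => ?_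
      rcases w with (i | m) | (i | m) <;> rfl
  | append_singleton gs g ih =>
    intro hB
    obtain ⟨F, hF, hFs⟩ := ih fun g' hg' => hB g' (List.mem_append_left _ hg')
    have hg : g.fn ∈ deMorganBasis := hB g (List.mem_append_right _ (List.mem_singleton_self g))
    simp only [deMorganBasis, Set.mem_insert_iff, Set.mem_singleton_iff] at hg
    set L := gs.length with hL
    -- the rerouting of the two copies of the new wire `inr L` to two fresh outputs
    let r : (ι ⊕ ℕ) ⊕ (ι ⊕ ℕ) → ((ι ⊕ ℕ) ⊕ (ι ⊕ ℕ)) ⊕ (Unit ⊕ Unit) := fun w =>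
      if w = Sum.inl (Sum.inr L) then Sum.inr (Sum.inl ())
      else if w = Sum.inr (Sum.inr L) then Sum.inr (Sum.inr ()) else Sum.inl w
    -- generic assembly: a 2-gate (or 0-gate) gadget computing the two new rails from old rails
    have assemble : ∀ (P N : ((ι ⊕ ℕ) ⊕ (ι ⊕ ℕ) → Bool) → Bool) (m : ℕ), m ≤ 2 →
        CktSize monotoneBasis01 (fun (z : (ι ⊕ ℕ) ⊕ (ι ⊕ ℕ) → Bool) =>
          Sum.elim z (Sum.elim (fun _ : Unit => P z) (fun _ : Unit => N z))) (0 + m) →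
        (∀ x, P (F (rails x)) = g.op (fun a => wireOf x (vals gs x) (g.args a))) →
        (∀ x, N (F (rails x)) = !g.op (fun a => wireOf x (vals gs x) (g.args a))) →
        ∃ F' : (ι ⊕ ι → Bool) → (ι ⊕ ℕ) ⊕ (ι ⊕ ℕ) → Bool,
          DRSpec (gs ++ [g]) F' ∧ CktSize monotoneBasis01 F' (2 + 2 * (gs ++ [g]).length) := by
      intro P N m hm hgad hP hN
      have hcomp := hFs.comp hgad
      refine ⟨_, ?_, (hcomp.outMap r).of_le (by simp; omega)⟩
      intro x w
      constructor
      · show Sum.elim (F (rails x)) _ (r (Sum.inl w)) = _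
        by_cases hw : w = Sum.inr L
        · subst hw
          rw [wireOf_vals_append_singleton_self]
          simp [r, hP x]
        · rw [wireOf_vals_append_singleton_of_ne _ _ _ hw]
          simp [r, hw, (hF x w).1]
      · show Sum.elim (F (rails x)) _ (r (Sum.inr w)) = _
        by_cases hw : w = Sum.inr L
        · subst hw
          rw [wireOf_vals_append_singleton_self]
          simp [r, hN x]
        · rw [wireOf_vals_append_singleton_of_ne _ _ _ hw]
          simp [r, hw, (hF x w).2]
    rcases hg with h | h | h
    · -- `∧`: positive rail `∧`, negative rail `∨`
      obtain ⟨u, v, rfl⟩ := exists_eq_andGate_of_fn_eq h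
      refine assemble (fun z => z (Sum.inl u) && z (Sum.inl v)) (fun z => z (Sum.inr u) || z (Sum.inr v))
        2 le_rfl ((CktSize.id monotoneBasis01).pair ((cktSize_and01 _ _).pair (cktSize_or01 _ _)))
        (fun x => ?_) fun x => ?_
      · rw [andGate_op, (hF x u).1, (hF x v).1]
      · rw [andGate_op, (hF x u).2, (hF x v).2, Bool.not_and]
    · -- `∨`: positive rail `∨`, negative rail `∧`
      obtain ⟨u, v, rfl⟩ := exists_eq_orGate_of_fn_eq h
      refine assemble (fun z => z (Sum.inl u) || z (Sum.inl v)) (fun z => z (Sum.inr u) && z (Sum.inr v))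
        2 le_rfl ((CktSize.id monotoneBasis01).pair ((cktSize_or01 _ _).pair (cktSize_and01 _ _)))
        (fun x => ?_) fun x => ?_
      · rw [orGate_op, (hF x u).1, (hF x v).1]
      · rw [orGate_op, (hF x u).2, (hF x v).2, Bool.not_or]
    · -- `¬`: swap the rails (no gate)
      obtain ⟨u, rfl⟩ := exists_eq_notGate_of_fn_eq h
      refine assemble (fun z => z (Sum.inr u)) (fun z => z (Sum.inl u)) 0 (by norm_num)
        (((CktSize.id monotoneBasis01).pair
          ((CktSize.proj monotoneBasis01 fun _ : Unit => (Sum.inr u : (ι ⊕ ℕ) ⊕ (ι ⊕ ℕ))).pair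
            (CktSize.proj monotoneBasis01 fun _ : Unit => (Sum.inl u : (ι ⊕ ℕ) ⊕ (ι ⊕ ℕ))))).congr
          fun z w => by rcases w with w | (w | w) <;> rfl)
        (fun x => ?_) fun x => ?_
      · simp [notGate, (hF x u).2]
      · simp [notGate, (hF x u).1]

/-- Programs over `{∧₂,∨₂,0,1}` compute monotone multi-output maps. [folklore] -/
theorem CktSize.monotone_of_monotoneBasis01 {κ : Type*} {F : (ι → Bool) → κ → Bool} {s : ℕ}
    (h : CktSize monotoneBasis01 F s) : Monotone F := by
  obtain ⟨gs, out, -, hR⟩ := h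
  intro y y' hyy' k
  rw [← hR.eval y k, ← hR.eval y' k]
  exact monotone_wireOf_vals_monotoneBasis01 gs hR.isOver (out k) hyy'

end DoubleRail

section Slice

variable {n : ℕ}

/-- **Berkowitz without the tightness bookkeeping.** A `k`-slice function with a `{∧₂,∨₂,¬}`-program
of `t` gates has a `{∧₂,∨₂,0,1}`-program of `c + (2 + 2t)` gates, where `c` gates compute all
pseudo-complements `Th_k(x - xᵢ)`: double-rail the program and feed the negative rail with the
pseudo-complements; correct on the slice by (10.1) `Th_k(x - xᵢ) = ¬xᵢ`, below/above it by the
monotone sandwich `F(x,0) ≤ F(x,¬x) ≤ F(x,1)` (Jukna 2012, Thm. 10.1). [cite: Jukna2012, Thm. 10.1] -/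
theorem cktSize_slice_of_deMorgan {k : ℕ} {f : (Fin n → Bool) → Bool} (hf : IsSliceFunction k f)
    {t : ℕ} (hC : CktSize deMorganBasis (fun x (_ : Unit) => f x) t) {c : ℕ}
    (hP : CktSize monotoneBasis01 (fun (x : Fin n → Bool) (i : Fin n) => pseudoComplement k i x) c) :
    CktSize monotoneBasis01 (fun x (_ : Unit) => f x) (c + (2 + 2 * t)) := by
  obtain ⟨gs, out, hl, hR⟩ := hC
  obtain ⟨F, hF, hFs⟩ := exists_doubleRail gs hR.isOver
  have hG : CktSize monotoneBasis01
      (fun x : Fin n → Bool => Sum.elim x fun i => pseudoComplement k i x) (0 + c) :=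
    (CktSize.id monotoneBasis01).pair hP
  have hH := (hG.comp hFs).outMap fun _ : Unit => (Sum.inl (out ()) : (Fin n ⊕ ℕ) ⊕ (Fin n ⊕ ℕ))
  refine (hH.of_le (by omega)).congr fun x _ => ?_
  have hmono := CktSize.monotone_of_monotoneBasis01 hFs
  have hslice : F (rails x) (Sum.inl (out ())) = f x := by rw [(hF x _).1, hR.eval x ()]
  show F (Sum.elim x fun i => pseudoComplement k i x) (Sum.inl (out ())) = f x
  rcases lt_trichotomy (hammingWeight x) k with hlt | heq | hgt
  · -- below the slice: pseudo-complements are `0`, `F(x,0) ≤ F(x,¬x) = f x = 0`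
    have hle : (Sum.elim x fun i => pseudoComplement k i x) ≤ rails x := by
      rintro (i | i)
      · exact le_rfl
      · simp [rails, pseudoComplement_eq_false_of_lt i x hlt]
    have := hmono hle (Sum.inl (out ()))
    rw [hslice, hf.1 x hlt] at this
    rw [hf.1 x hlt]
    exact le_antisymm this (Bool.false_le _)
  · -- on the slice: (10.1)
    have : (Sum.elim x fun i => pseudoComplement k i x) = rails x := by
      ext (i | i)
      · rfl
      · exact pseudoComplement_eq_not i x heq
    rw [this, hslice]
  · -- above the slice: pseudo-complements are `1`, `1 = f x = F(x,¬x) ≤ F(x,1)`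
    have hle : rails x ≤ (Sum.elim x fun i => pseudoComplement k i x) := by
      rintro (i | i)
      · exact le_rfl
      · simp [rails, pseudoComplement_eq_true_of_lt i x hgt]
    have := hmono hle (Sum.inl (out ()))
    rw [hslice, hf.2 x hgt] at this
    rw [hf.2 x hgt]
    exact le_antisymm (Bool.le_true _) this

/-- A circuit realises its own function as a program. [folklore] -/
theorem cktSize_of_circuit {ι : Type*} {B : Set GateFn} (C : Circuit ι) (hB : C.IsOver B)
    {f : (ι → Bool) → Bool} (hf : C.Computes f) : CktSize B (fun x (_ : Unit) => f x) C.size :=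
  ⟨C.gates, fun _ => C.output, le_rfl,
    ⟨wf_gates C, hB, fun _ m hm => C.wf_output m hm, fun x _ => (circuit_eval C x).symm.trans (hf x)⟩⟩

/-- `{∧₂,∨₂,0,1} ⊆ B_s` for `s ≥ 1` (constants are CONV gates of width `≤ 1`). [folklore] -/
theorem monotoneBasis01_subset_extGate {s : ℕ} (hs : 1 ≤ s) : monotoneBasis01 ⊆ extGate s := by
  intro g hg
  simp only [monotoneBasis01, monotoneBasis, Set.mem_insert_iff, Set.mem_singleton_iff] at hg
  rcases hg with rfl | rfl | rfl | rfl
  · -- `1`: no constraint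
    refine IsConvGate.mem_extGate ⟨0, 0, by omega, fun _ => 0, fun _ => 0, fun _ _ => 0,
      fun _ _ => le_rfl, fun v => ?_⟩
    show true = true ↔ _
    simp only [true_iff]
    exact ⟨0, Matrix.PosSemidef.zero, fun i => i.elim0⟩
  · -- `0`: the infeasible constraint `0 ≤ -1`
    refine IsConvGate.mem_extGate ⟨1, 0, hs, fun _ => 0, fun _ => -1, fun _ _ => 0,
      fun _ _ => le_rfl, fun v => ?_⟩
    show false = true ↔ _
    simp only [Bool.false_eq_true, false_iff, not_exists, not_and, not_forall, not_le]
    intro Y _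
    exact ⟨0, by simp⟩
  · exact and_mem_extGate s
  · exact or_mem_extGate s

/-- **`Capture` holds for slice functions — with NO wide gate** (Berkowitz 1982 / Jukna 2012 Thm. 10.1,
assembled: `B₂ → {∧,∨,¬}` (`12t+3` gates), double rail (`2 + 2·(12t+3)`), pseudo-complements
(`c·n·log² n`), hence `≤ (t+n+2)^a` for an absolute `a`; small `n < n₀` by monotone Shannon expansion).
So a counterexample to the crux is far from the slices: together with §9 (few minterms / few maxterms
⇒ ONE CONV gate) the counterexample space is "non-sliceable monotone P-functions with super-polynomially
many minterms and maxterms" — matching, Tardos's function, LIN-UNSAT are of this kind, slices of NP-hard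
functions (the OneSlice route) are not. [cite: Jukna2012, Thm. 10.1] -/
theorem captureSlice_monotoneBasis01 : ∃ a : ℕ, ∀ (n k : ℕ) (f : (Fin n → Bool) → Bool), Monotone f →
    IsSliceFunction k f → ∀ C : Circuit (Fin n), C.IsOver B2 → C.Computes f →
      ∃ C' : Circuit (Fin n), C'.IsOver monotoneBasis01 ∧ C'.size ≤ (C.size + n + 2) ^ a ∧
        C'.Computes f := by
  obtain ⟨c, n₀, hP⟩ := pseudoComplements_cktSize_holds
  refine ⟨n₀ + c + 30, fun n k f hmono hf C hB hcomp => ?_⟩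
  have hbase : 2 ≤ C.size + n + 2 := by omega
  rcases Nat.lt_or_ge n (max n₀ 1) with hsmall | hbig
  · -- small `n`: monotone Shannon expansion, `monoBound n ≤ 3·2^n` gates
    obtain ⟨C', hB', hs', hev'⟩ :=
      (cktSize_monotone_univ_fin n (fun x _ => f x) fun x y hxy _ => hmono hxy).toCircuit
    refine ⟨C', hB', hs'.trans ?_, fun x => hev' x⟩
    have hmb : ∀ m, monoBound m + 2 ≤ 3 * 2 ^ m := fun m => by
      induction m with
      | zero => simp [monoBound]
      | succ m ih => simp only [monoBound, pow_succ]; omega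
    have hn : n ≤ n₀ := by omega
    calc monoBound n ≤ 3 * 2 ^ n := by have := hmb n; omega
      _ ≤ 4 * 2 ^ n₀ := by
          have := Nat.pow_le_pow_right (show 1 ≤ 2 by norm_num) hn
          omega
      _ = 2 ^ (n₀ + 2) := by ring
      _ ≤ (C.size + n + 2) ^ (n₀ + 2) := Nat.pow_le_pow_left hbase _
      _ ≤ (C.size + n + 2) ^ (n₀ + c + 30) := Nat.pow_le_pow_right (by omega) (by omega)
  · -- `n ≥ n₀`, `n ≥ 1`
    have hn1 : 1 ≤ n := le_trans (le_max_right _ _) hbig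
    have hn0 : n₀ ≤ n := le_trans (le_max_left _ _) hbig
    have h1 := (cktSize_of_circuit C hB hcomp).deMorgan_of_B2 ⟨0, hn1⟩
    have h2 := cktSize_slice_of_deMorgan hf h1 (hP n hn0 k)
    obtain ⟨C', hB', hs', hev'⟩ := h2.toCircuit
    refine ⟨C', hB', hs'.trans ?_, fun x => hev' x⟩
    set N := C.size + n + 2 with hN
    have hlog : Nat.log 2 n ≤ n := (Nat.log_lt_self 2 (by omega)).le
    have hn3 : n * Nat.log 2 n ^ 2 ≤ N ^ 3 := by
      calc n * Nat.log 2 n ^ 2 ≤ n * n ^ 2 := Nat.mul_le_mul_left _ (Nat.pow_le_pow_left hlog 2)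
        _ = n ^ 3 := by ring
        _ ≤ N ^ 3 := Nat.pow_le_pow_left (by omega) 3
    have hN3 : N ≤ N ^ 3 := by
      calc N = N ^ 1 := (pow_one N).symm
        _ ≤ N ^ 3 := Nat.pow_le_pow_right (by omega) (by norm_num)
    have h2c : c + 27 ≤ 2 ^ (c + 27) := (Nat.lt_two_pow_self).le
    calc c * (n * Nat.log 2 n ^ 2) + (2 + 2 * (12 * C.size + 3))
        ≤ c * N ^ 3 + 26 * N := add_le_add (Nat.mul_le_mul_left c hn3) (by omega)
      _ ≤ c * N ^ 3 + 26 * N ^ 3 := by have := Nat.mul_le_mul_left 26 hN3; omega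
      _ = (c + 26) * N ^ 3 := by ring
      _ ≤ 2 ^ (c + 27) * N ^ 3 := Nat.mul_le_mul_right _ (by omega)
      _ ≤ N ^ (c + 27) * N ^ 3 := Nat.mul_le_mul_right _ (Nat.pow_le_pow_left hbase _)
      _ = N ^ (c + 27 + 3) := by rw [← pow_add]
      _ ≤ N ^ (n₀ + c + 30) := Nat.pow_le_pow_right (by omega) (by omega)

/-- The same with the crux's target basis: `Capture` restricted to slice functions is a THEOREM (the
simulating circuit lives in `{∧₂,∨₂,0,1} ⊆ B_1 ⊆ B_N`). [cite: Jukna2012, Thm. 10.1] -/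
theorem captureSlice : ∃ a : ℕ, ∀ (n k : ℕ) (f : (Fin n → Bool) → Bool), Monotone f →
    IsSliceFunction k f → ∀ C : Circuit (Fin n), C.IsOver B2 → C.Computes f →
      ∃ C' : Circuit (Fin n), C'.IsOver (extGate ((C.size + n + 2) ^ a)) ∧
        C'.size ≤ (C.size + n + 2) ^ a ∧ C'.Computes f := by
  obtain ⟨a, h⟩ := captureSlice_monotoneBasis01
  refine ⟨a, fun n k f hmono hf C hB hcomp => ?_⟩
  obtain ⟨C', hB', hs', hev'⟩ := h n k f hmono hf C hB hcomp
  exact ⟨C', hB'.mono (monotoneBasis01_subset_extGate (Nat.one_le_pow _ _ (by omega))), hs', hev'⟩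

end Slice

end Summit.PneNP.PneNP.Theorems.Capture.Negative
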